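import Literature.NumberTheory.Sieve.MatomakiRadziwillProp1Inputs
import Literature.NumberTheory.LFunctions.DirichletPolynomialLargeValues
import Mathlib.NumberTheory.EulerProduct.Basic
import Mathlib.Analysis.PSeries
import HarnessLib

/-!
# Matomäki–Radziwiłł 2016, Lemma 13 (moment computation): proved

Topic `Literature/NumberTheory/Sieve`.  Everything in this file is PROVED; it discharges the named fact
`Literature.NumberTheory.Sieve.MatomakiRadziwill2016_lemma13` of `MatomakiRadziwillProp1Inputs.lean`
(K. Matomäki, M. Radziwiłł, *Multiplicative functions in short intervals*, Ann. of Math. 183 (2016), §6,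
Lemma 13: for `Q(s) = ∑_{Y₁ ≤ p ≤ 2Y₁} c_p p^{-s}`, `A(s) = ∑_{X/Y₂ ≤ m ≤ 2X/Y₂} a_m m^{-s}`,
`|a_m|, |c_p| ≤ 1`, `ℓ = ⌈log Y₂/log Y₁⌉`:
`∫_{-T}^{T} |Q(1+it)^ℓ A(1+it)|² dt ≪ (T/X + 2^ℓ Y₁) ((ℓ+1)!)²`), one of the inputs of the proof of
MR's Proposition 1 (§8.2, the bound for `E_j`), and thereby of `matomaki_radziwill`,
`MatomakiRadziwillTao2015_propA3`, `MatomakiRadziwillTao2015_theorem17`.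

* `MatomakiRadziwill2016_lemma13_holds : MatomakiRadziwill2016_lemma13`, with `C = 72 e^{102}`.

## The proof (the printed one, §6, made elementary)

1. *Expansion* (`MatomakiRadziwillL13.pow_mul_eq_sum_coeffB`): `Q(s)^ℓ A(s) = ∑_{n ≤ N} b_n n^{-s}`,
   `b_n = ∑_{m p₁⋯p_ℓ = n} a_m c_{p₁}⋯c_{p_ℓ}` (indices `(p⃗, m) ∈ S^ℓ × M`), `N = ⌊2X/Y₂⌋ ⌊2Y₁⌋^ℓ ≤ 2^{ℓ+1} X Y₁`
   (as `Y₁^{ℓ-1} < Y₂`), and `b_n = 0` unless `n ≥ X` (as `Y₁^ℓ ≥ Y₂`).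
2. *Coefficients* (`norm_coeffB_le`): `|b_n| ≤ ℓ! · D_S(n)`, `D_S(n)` the number of divisors of `n` composed
   of primes of `S = 𝒫 ∩ [Y₁, 2Y₁]` — the paper's `ℓ! g(n)`: at most `ℓ!` ordered prime tuples have a given
   product (`LFunctions.DirichletLargeValues.card_filter_prod_eq_le_factorial`).
3. *Mean value theorem* (`LFunctions.dirichletPolynomial_meanSquare_le`, the paper's Lemma 6 in the explicit
   form `∫_{-T}^{T} |∑_{n ≤ N} d_n n^{-it}|² ≤ (5T + 18N) ∑ |d_n|²`) with `d_n = b_n/n`.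
4. *The divisor sum* (`sum_sDivCount_sq_le`, replacing Shiu's theorem [Shiu80] of the printed proof by an
   elementary count): `∑_{n ≥ X'} D_S(n)²/n² ≤ (2/X') e^{102}`: write `n = r m` with `r = s_S(n)` the
   `S`-part (`sPart`; the map `n ↦ (r, m)` is injective and `D_S(n) ≤ σ₀(r)`), bound the cofactor sum
   `∑_{m ≥ X'/r} 1/m² ≤ 2r/X'` (Mathlib `sum_Ioo_inv_sq_le`), and sum `σ₀(r)²/r` over `S`-factored `r` by the
   Euler product (Mathlib `EulerProduct.summable_and_hasSum_factoredNumbers_prod_filter_prime_tsum`):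
   `∏_{p ∈ S} ∑_ν (ν+1)²/p^ν ≤ ∏ (1 + 4/p + 128/p²) ≤ exp(#S · (4/Y₁ + 128/Y₁²)) ≤ e^{102}`
   (`#S ≤ Y₁ + 1`, `p ≥ Y₁ ≥ 2`; `(k+3)² ≤ 16 (7/4)^k` gives the `128/p²`).

History: an earlier discharge of this fact (proposal p14855, same architecture) was reviewed favourably but
could not be rebased across the 2026-08-14 namespace rename; this file is an independent re-proof.

## References
* K. Matomäki, M. Radziwiłł, Ann. of Math. (2) 183 (2016), 1015–1056 (arXiv:1501.04585), §6, Lemma 13 and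
  its proof. [cite: MatomakiRadziwillAnnals2016, Lemma 13]
* P. Shiu, *A Brun–Titchmarsh theorem for multiplicative functions*, J. reine angew. Math. 313 (1980) — the
  input of the printed proof, NOT used here.

## Design choices
* `S`, `ℓ`, `M`, the polynomials and all ranges are literally those of the fact (`Icc ⌈Y₁⌉₊ ⌊2Y₁⌋₊` filtered
  by `Nat.Prime`, `ℓ = ⌈log Y₂/log Y₁⌉₊`, `Icc ⌈X/Y₂⌉₊ ⌊2X/Y₂⌋₊`); the constant is explicit and crude.
* The combinatorial objects (`sPart`, `wt`, `sDivCount`, `idxVal`, `idxWt`, `coeffB`) live in the sub-namespace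
  `MatomakiRadziwillL13`; none is needed downstream.
-/

noncomputable section

open Finset Real Complex MeasureTheory
open scoped ArithmeticFunction.sigma

namespace Literature.NumberTheory.Sieve

namespace MatomakiRadziwillL13

/-! ### The `S`-part of an integer and its `S`-factored divisors -/

/-- The `S`-part of `n`: `s_S(n) = ∏_{p ∈ S} p^{v_p(n)}` (for a finite set of primes `S`). [folklore] -/
def sPart (S : Finset ℕ) (n : ℕ) : ℕ := ∏ p ∈ S, p ^ n.factorization p

/-- `s_S(n) ≥ 1`. [folklore] -/
theorem sPart_pos {S : Finset ℕ} (hS : ∀ p ∈ S, p.Prime) (n : ℕ) : 0 < sPart S n :=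
  Finset.prod_pos fun p hp => pow_pos (hS p hp).pos _

/-- `s_S(n) ∣ n`. [folklore] -/
theorem sPart_dvd {S : Finset ℕ} (hS : ∀ p ∈ S, p.Prime) (n : ℕ) : sPart S n ∣ n := by
  classical
  induction S using Finset.induction_on with
  | empty => simp [sPart]
  | insert p S hp ih =>
    have hS' : ∀ q ∈ S, q.Prime := fun q hq => hS q (Finset.mem_insert_of_mem hq)
    have hpp : p.Prime := hS p (Finset.mem_insert_self p S)
    unfold sPart at ih ⊢
    rw [Finset.prod_insert hp]
    refine Nat.Coprime.mul_dvd_of_dvd_of_dvd ?_ (Nat.ordProj_dvd n p) (ih hS')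
    refine Nat.Coprime.prod_right fun q hq => ?_
    have hpq : p ≠ q := fun h => hp (h ▸ hq)
    exact Nat.coprime_pow_primes _ _ hpp (hS' q hq) hpq

/-- The prime factors of `s_S(n)` lie in `S`. [folklore] -/
theorem primeFactors_sPart_subset {S : Finset ℕ} (hS : ∀ p ∈ S, p.Prime) (n : ℕ) :
    (sPart S n).primeFactors ⊆ S := by
  intro q hq
  rw [Nat.mem_primeFactors] at hq
  obtain ⟨hqp, hqd, -⟩ := hq
  unfold sPart at hqd
  obtain ⟨p, hp, hdvd⟩ := ((Nat.prime_iff.mp hqp).dvd_finsetProd_iff _).1 hqd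
  have h1 : q ∣ p := hqp.dvd_of_dvd_pow hdvd
  rwa [(Nat.prime_dvd_prime_iff_eq hqp (hS p hp)).1 h1]

/-- `s_S(n)` is an `S`-factored number. [folklore] -/
theorem sPart_mem_factoredNumbers {S : Finset ℕ} (hS : ∀ p ∈ S, p.Prime) (n : ℕ) :
    sPart S n ∈ Nat.factoredNumbers S := by
  rw [Nat.mem_factoredNumbers_iff_primeFactors_subset]
  exact ⟨(sPart_pos hS n).ne', primeFactors_sPart_subset hS n⟩

/-- An `S`-factored divisor of `n ≠ 0` divides `s_S(n)`. [folklore] -/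
theorem dvd_sPart_of_dvd {S : Finset ℕ} {n r : ℕ} (hn : n ≠ 0)
    (hr : r ∣ n) (hrS : r.primeFactors ⊆ S) : r ∣ sPart S n := by
  have hr0 : r ≠ 0 := fun h => hn (by rw [h] at hr; exact zero_dvd_iff.1 hr)
  rw [Nat.dvd_iff_prime_pow_dvd_dvd]
  intro p k hp hpk
  rcases Nat.eq_zero_or_pos k with rfl | hk
  · simp
  have hpP : p.Prime := hp
  have hpr : p ∣ r := (dvd_pow_self p hk.ne').trans hpk
  have hpS : p ∈ S := hrS (Nat.mem_primeFactors.2 ⟨hpP, hpr, hr0⟩)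
  have hkle : k ≤ n.factorization p := (hpP.pow_dvd_iff_le_factorization hn).1 (hpk.trans hr)
  calc p ^ k ∣ p ^ n.factorization p := pow_dvd_pow p hkle
    _ ∣ sPart S n := Finset.dvd_prod_of_mem (fun q => q ^ n.factorization q) hpS

/-- The number of `S`-factored divisors of `n ≠ 0` is at most `σ₀(s_S(n))`. [folklore] -/
theorem card_sDivisors_le_sigma {S : Finset ℕ} (hS : ∀ p ∈ S, p.Prime) {n : ℕ} (hn : n ≠ 0) :
    #(n.divisors.filter (fun r => r.primeFactors ⊆ S)) ≤ σ 0 (sPart S n) := by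
  rw [ArithmeticFunction.sigma_zero_apply]
  refine Finset.card_le_card_of_injOn id (fun r hr => ?_) (Set.injOn_id _)
  rw [Finset.mem_coe, Finset.mem_filter, Nat.mem_divisors] at hr
  rw [Finset.mem_coe, Nat.mem_divisors]
  exact ⟨dvd_sPart_of_dvd hn hr.1.1 hr.2, (sPart_pos hS n).ne'⟩

/-- `s_S(n) ≤ n` for `n ≠ 0`. [folklore] -/
theorem sPart_le {S : Finset ℕ} (hS : ∀ p ∈ S, p.Prime) {n : ℕ} (hn : n ≠ 0) : sPart S n ≤ n :=
  Nat.le_of_dvd (Nat.pos_of_ne_zero hn) (sPart_dvd hS n)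

/-! ### The Euler product bound `∑_{r S-factored} σ₀(r)²/r ≤ e^{102}` -/

/-- The weight `f(r) = σ₀(r)²/r`. [folklore] -/
def wt (r : ℕ) : ℝ := ((σ 0 r : ℕ) : ℝ) ^ 2 / r

/-- `f ≥ 0`. [folklore] -/
theorem wt_nonneg (r : ℕ) : 0 ≤ wt r := by unfold wt; positivity

/-- `f(1) = 1`. [folklore] -/
theorem wt_one : wt 1 = 1 := by simp [wt]

/-- `f` is multiplicative on coprime arguments. [folklore] -/
theorem wt_mul {m n : ℕ} (h : Nat.Coprime m n) : wt (m * n) = wt m * wt n := by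
  unfold wt
  rw [ArithmeticFunction.isMultiplicative_sigma.map_mul_of_coprime h]
  push_cast
  rcases eq_or_ne m 0 with rfl | hm
  · simp
  rcases eq_or_ne n 0 with rfl | hn
  · simp
  field_simp

/-- `f(p^ν) = (ν+1)²/p^ν` for `p` prime. [folklore] -/
theorem wt_prime_pow {p : ℕ} (hp : p.Prime) (ν : ℕ) :
    wt (p ^ ν) = ((ν : ℝ) + 1) ^ 2 / (p : ℝ) ^ ν := by
  unfold wt
  rw [ArithmeticFunction.sigma_zero_apply_prime_pow hp]
  push_cast
  ring

/-- `(k+3)² ≤ 16 (7/4)^k`. [folklore] -/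
theorem sq_le_geom (k : ℕ) : ((k : ℝ) + 3) ^ 2 ≤ 16 * (7 / 4 : ℝ) ^ k := by
  induction k with
  | zero => norm_num
  | succ k ih =>
    rcases Nat.lt_or_ge k 1 with hk | hk
    · interval_cases k; norm_num
    · have hk1 : (1 : ℝ) ≤ k := by exact_mod_cast hk
      push_cast
      have h74 : 16 * (7 / 4 : ℝ) ^ (k + 1) = (7 / 4) * (16 * (7 / 4 : ℝ) ^ k) := by ring
      rw [h74]
      nlinarith

/-- **The local factor**: `∑_ν (ν+1)²/p^ν ≤ 1 + 4/p + 128/p²` for `p ≥ 2`, and the series is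
summable. [folklore] -/
theorem tsum_wt_prime_pow_le {p : ℕ} (hp : p.Prime) :
    Summable (fun ν : ℕ => ‖wt (p ^ ν)‖) ∧
      ∑' ν : ℕ, wt (p ^ ν) ≤ 1 + 4 / (p : ℝ) + 128 / (p : ℝ) ^ 2 := by
  have hp2 : (2 : ℝ) ≤ p := by exact_mod_cast hp.two_le
  have hp0 : (0 : ℝ) < p := by linarith
  set x : ℝ := 1 / p with hx
  have hx0 : 0 ≤ x := by positivity
  have hx12 : x ≤ 1 / 2 := by rw [hx]; exact one_div_le_one_div_of_le (by norm_num) hp2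
  -- termwise: `wt (p^ν) = (ν+1)² x^ν`
  have hterm : ∀ ν : ℕ, wt (p ^ ν) = ((ν : ℝ) + 1) ^ 2 * x ^ ν := by
    intro ν; rw [wt_prime_pow hp, hx, one_div_pow]; ring
  -- the geometric majorant for `ν ≥ 2`: `(k+3)² x^{k+2} ≤ 16 x² (7x/4)^k`
  set g : ℕ → ℝ := fun k => 16 * x ^ 2 * (7 / 4 * x) ^ k with hg
  have hq : 7 / 4 * x < 1 := by nlinarith
  have hq0 : 0 ≤ 7 / 4 * x := by positivity
  have hgsum : Summable g := (summable_geometric_of_lt_one hq0 hq).mul_left _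
  have hshift : ∀ k : ℕ, wt (p ^ (k + 2)) ≤ g k := by
    intro k
    rw [hterm, hg]
    have e : ((((k + 2 : ℕ) : ℝ)) + 1) ^ 2 * x ^ (k + 2) = ((k : ℝ) + 3) ^ 2 * x ^ k * x ^ 2 := by
      push_cast; ring
    rw [e]
    show ((k : ℝ) + 3) ^ 2 * x ^ k * x ^ 2 ≤ 16 * x ^ 2 * (7 / 4 * x) ^ k
    rw [show 16 * x ^ 2 * (7 / 4 * x) ^ k = (16 * (7 / 4 : ℝ) ^ k) * x ^ k * x ^ 2 by
      rw [mul_pow]; ring]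
    exact mul_le_mul_of_nonneg_right (mul_le_mul_of_nonneg_right (sq_le_geom k) (by positivity))
      (by positivity)
  have hnn : ∀ ν, 0 ≤ wt (p ^ ν) := fun ν => wt_nonneg _
  -- summability of the shifted sequence, hence of the whole one
  have hs2 : Summable (fun k : ℕ => wt (p ^ (k + 2))) :=
    Summable.of_nonneg_of_le (fun k => hnn _) hshift hgsum
  have hs : Summable (fun ν : ℕ => wt (p ^ ν)) := by
    rw [← summable_nat_add_iff 2]; exact hs2
  refine ⟨hs.norm, ?_⟩
  rw [hs.tsum_eq_zero_add, (summable_nat_add_iff 1 |>.2 hs).tsum_eq_zero_add]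
  simp only [zero_add]
  have h0 : wt (p ^ 0) = 1 := by rw [pow_zero, wt_one]
  have h1 : wt (p ^ 1) = 4 / p := by rw [hterm, pow_one, hx]; ring
  have htail : ∑' k : ℕ, wt (p ^ (k + 1 + 1)) ≤ 128 / (p : ℝ) ^ 2 := by
    have e : (fun k : ℕ => wt (p ^ (k + 1 + 1))) = fun k => wt (p ^ (k + 2)) := by
      funext k; rfl
    rw [e]
    calc ∑' k : ℕ, wt (p ^ (k + 2)) ≤ ∑' k : ℕ, g k := hs2.tsum_le_tsum hshift hgsum
      _ = 16 * x ^ 2 * (1 - 7 / 4 * x)⁻¹ := by rw [hg, tsum_mul_left, tsum_geometric_of_lt_one hq0 hq]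
      _ ≤ 16 * x ^ 2 * 8 := by
          refine mul_le_mul_of_nonneg_left ?_ (by positivity)
          rw [inv_le_comm₀ (by nlinarith) (by norm_num)]; nlinarith
      _ = 128 / (p : ℝ) ^ 2 := by rw [hx]; field_simp; norm_num
  rw [h0, h1]
  linarith

/-- **The Euler product bound**: for a finite set `S` of primes, all `≥ Y₁ ≥ 2`, with
`#S ≤ Y₁ + 1`, and any finite set `R` of `S`-factored numbers, `∑_{r ∈ R} σ₀(r)²/r ≤ e^{102}`
(`∑ ≤ ∏_{p ∈ S} ∑_ν (ν+1)²/p^ν ≤ ∏ (1 + 4/p + 128/p²) ≤ exp(#S (4/Y₁ + 128/Y₁²)) ≤ e^{102}`).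
[folklore] -/
theorem sum_wt_le {S R : Finset ℕ} {Y₁ : ℝ} (hY₁ : 2 ≤ Y₁) (hS : ∀ p ∈ S, p.Prime)
    (hSY : ∀ p ∈ S, Y₁ ≤ p) (hcard : (#S : ℝ) ≤ Y₁ + 1) (hR : ∀ r ∈ R, r ∈ Nat.factoredNumbers S) :
    ∑ r ∈ R, wt r ≤ Real.exp 102 := by
  classical
  -- Euler product over `S`-factored numbers
  have hE := EulerProduct.summable_and_hasSum_factoredNumbers_prod_filter_prime_tsum
    (f := wt) wt_one (fun h => wt_mul h) (fun hp => (tsum_wt_prime_pow_le hp).1) S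
  have hfilter : S.filter Nat.Prime = S := Finset.filter_true_of_mem hS
  rw [hfilter] at hE
  -- the finite sum over `R` is a partial sum of the series
  set R' : Finset (Nat.factoredNumbers S) := R.attach.map
    ⟨fun r => ⟨r.1, hR r.1 r.2⟩, fun a b h => Subtype.ext (by
      have := congrArg Subtype.val h; simpa using this)⟩ with hR'
  have hsumR : ∑ r ∈ R, wt r = ∑ m ∈ R', wt (m : ℕ) := by
    rw [hR', Finset.sum_map, ← Finset.sum_attach R]
    rfl
  have hle : ∑ m ∈ R', wt (m : ℕ) ≤ ∏ p ∈ S, ∑' ν : ℕ, wt (p ^ ν) :=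
    sum_le_hasSum R' (fun m _ => wt_nonneg _) hE.2
  -- bound each local factor and the product
  have hfac : ∀ p ∈ S, ∑' ν : ℕ, wt (p ^ ν) ≤ Real.exp (4 / Y₁ + 128 / Y₁ ^ 2) := by
    intro p hp
    have hpY := hSY p hp
    have hp0 : (0 : ℝ) < p := by linarith
    have h1 := (tsum_wt_prime_pow_le (hS p hp)).2
    have h2 : 4 / (p : ℝ) + 128 / (p : ℝ) ^ 2 ≤ 4 / Y₁ + 128 / Y₁ ^ 2 := by
      gcongr
    calc ∑' ν : ℕ, wt (p ^ ν) ≤ 1 + (4 / (p : ℝ) + 128 / (p : ℝ) ^ 2) := by linarith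
      _ ≤ Real.exp (4 / (p : ℝ) + 128 / (p : ℝ) ^ 2) := by
          have := Real.add_one_le_exp (4 / (p : ℝ) + 128 / (p : ℝ) ^ 2); linarith
      _ ≤ Real.exp (4 / Y₁ + 128 / Y₁ ^ 2) := Real.exp_le_exp.2 h2
  have hfac0 : ∀ p ∈ S, 0 ≤ ∑' ν : ℕ, wt (p ^ ν) := fun p _ => tsum_nonneg fun ν => wt_nonneg _
  have hprod : ∏ p ∈ S, ∑' ν : ℕ, wt (p ^ ν) ≤ Real.exp (4 / Y₁ + 128 / Y₁ ^ 2) ^ #S :=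
    calc ∏ p ∈ S, ∑' ν : ℕ, wt (p ^ ν) ≤ ∏ p ∈ S, Real.exp (4 / Y₁ + 128 / Y₁ ^ 2) :=
          Finset.prod_le_prod hfac0 hfac
      _ = Real.exp (4 / Y₁ + 128 / Y₁ ^ 2) ^ #S := Finset.prod_const _
  have hexp : Real.exp (4 / Y₁ + 128 / Y₁ ^ 2) ^ #S ≤ Real.exp 102 := by
    rw [← Real.exp_nat_mul]
    refine Real.exp_le_exp.2 ?_
    have hY0 : 0 < Y₁ := by linarith
    have h1 : (#S : ℝ) * (4 / Y₁ + 128 / Y₁ ^ 2) ≤ (Y₁ + 1) * (4 / Y₁ + 128 / Y₁ ^ 2) :=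
      mul_le_mul_of_nonneg_right hcard (by positivity)
    have h2 : (Y₁ + 1) * (4 / Y₁ + 128 / Y₁ ^ 2) ≤ 102 := by
      rw [show (Y₁ + 1) * (4 / Y₁ + 128 / Y₁ ^ 2) = 4 + 132 / Y₁ + 128 / Y₁ ^ 2 by field_simp; ring]
      have h3 : 132 / Y₁ ≤ 66 := by rw [div_le_iff₀ hY0]; linarith
      have h4 : 128 / Y₁ ^ 2 ≤ 32 := by rw [div_le_iff₀ (by positivity)]; nlinarith
      linarith
    linarith
  calc ∑ r ∈ R, wt r = ∑ m ∈ R', wt (m : ℕ) := hsumR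
    _ ≤ ∏ p ∈ S, ∑' ν : ℕ, wt (p ^ ν) := hle
    _ ≤ Real.exp (4 / Y₁ + 128 / Y₁ ^ 2) ^ #S := hprod
    _ ≤ Real.exp 102 := hexp


/-! ### Summing `D_S(n)²/n²` over `n ≥ X'` -/

/-- `D_S(n)`: the number of `S`-factored divisors of `n`. [folklore] -/
def sDivCount (S : Finset ℕ) (n : ℕ) : ℕ := #(n.divisors.filter (fun r => r.primeFactors ⊆ S))

/-- `∑_{m ∈ [1, N], rm ≥ X'} 1/m² ≤ 2r/X'` for `r, X' ≥ 1`. [folklore] -/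
theorem sum_inv_sq_filter_le {X' N r : ℕ} (hX' : 1 ≤ X') (hr : 1 ≤ r) :
    ∑ m ∈ (Finset.Icc 1 N).filter (fun m => X' ≤ r * m), (1 : ℝ) / (m : ℝ) ^ 2 ≤ 2 * r / X' := by
  have hr0 : (0 : ℝ) < r := by exact_mod_cast hr
  have hX0 : (0 : ℝ) < X' := by exact_mod_cast hX'
  set M : ℕ := ⌈(X' : ℝ) / r⌉₊ with hM
  have hM1 : 1 ≤ M := Nat.one_le_iff_ne_zero.2 (by
    rw [hM]; exact (Nat.ceil_pos.2 (by positivity)).ne')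
  have hsub : (Finset.Icc 1 N).filter (fun m => X' ≤ r * m) ⊆ Finset.Ioo (M - 1) (N + 1) := by
    intro m hm
    rw [Finset.mem_filter, Finset.mem_Icc] at hm
    rw [Finset.mem_Ioo]
    refine ⟨?_, by omega⟩
    have h1 : (X' : ℝ) / r ≤ m := by
      rw [div_le_iff₀ hr0]
      have : ((X' : ℕ) : ℝ) ≤ ((r * m : ℕ) : ℝ) := by exact_mod_cast hm.2
      push_cast at this; linarith
    have : M ≤ m := Nat.ceil_le.2 h1
    omega
  calc ∑ m ∈ (Finset.Icc 1 N).filter (fun m => X' ≤ r * m), (1 : ℝ) / (m : ℝ) ^ 2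
      ≤ ∑ m ∈ Finset.Ioo (M - 1) (N + 1), (1 : ℝ) / (m : ℝ) ^ 2 :=
        Finset.sum_le_sum_of_subset_of_nonneg hsub fun _ _ _ => by positivity
    _ = ∑ m ∈ Finset.Ioo (M - 1) (N + 1), ((m : ℝ) ^ 2)⁻¹ := by simp [one_div]
    _ ≤ 2 / ((M - 1 : ℕ) + 1) := sum_Ioo_inv_sq_le _ _
    _ = 2 / M := by rw [Nat.cast_sub hM1]; push_cast; ring_nf
    _ ≤ 2 * r / X' := by
        have hMge : (X' : ℝ) / r ≤ M := by rw [hM]; exact Nat.le_ceil _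
        have hM0 : (0 : ℝ) < M := by exact_mod_cast hM1
        rw [div_le_div_iff₀ hM0 hX0]
        rw [div_le_iff₀ hr0] at hMge
        nlinarith

/-- **The Shiu-type bound, elementary form**: for `S` a set of primes in `[Y₁, ∞)`, `#S ≤ Y₁ + 1`,
`Y₁ ≥ 2`, and `X' ≥ 1`, `∑_{X' ≤ n ≤ N} D_S(n)²/n² ≤ (2/X') e^{102}`.  Proof: `n ↦ (s_S(n), n/s_S(n))`
is injective, `D_S(n) ≤ σ₀(s_S(n))`, the cofactor sum is `∑_{m ≥ X'/r} 1/m² ≤ 2r/X'`, and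
`∑_r σ₀(r)²/r ≤ e^{102}` (`sum_wt_le`). [cite: MatomakiRadziwillAnnals2016, Lemma 13 (proof, the bound via Shiu's theorem)] -/
theorem sum_sDivCount_sq_le {S : Finset ℕ} {Y₁ : ℝ} (hY₁ : 2 ≤ Y₁) (hS : ∀ p ∈ S, p.Prime)
    (hSY : ∀ p ∈ S, Y₁ ≤ p) (hcard : (#S : ℝ) ≤ Y₁ + 1) {X' N : ℕ} (hX' : 1 ≤ X') :
    ∑ n ∈ Finset.Icc X' N, (sDivCount S n : ℝ) ^ 2 / (n : ℝ) ^ 2 ≤ 2 / X' * Real.exp 102 := by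
  classical
  have hX0 : (0 : ℝ) < X' := by exact_mod_cast hX'
  -- the reindexing map and its target
  set φ : ℕ → ℕ × ℕ := fun n => (sPart S n, n / sPart S n) with hφ
  set R : Finset ℕ := (Finset.Icc 1 N).filter (fun r => r ∈ Nat.factoredNumbers S) with hR
  set Tgt : Finset (ℕ × ℕ) := (R ×ˢ Finset.Icc 1 N).filter (fun x => X' ≤ x.1 * x.2) with hTgt
  set F : ℕ × ℕ → ℝ := fun x => wt x.1 / (x.1 * (x.2 : ℝ) ^ 2) with hF
  have hF0 : ∀ x, 0 ≤ F x := fun x => by simp only [hF]; exact div_nonneg (wt_nonneg _) (by positivity)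
  -- pointwise: `D_S(n)²/n² ≤ F(φ n)` and `φ n ∈ Tgt`
  have hmul : ∀ n, sPart S n * (n / sPart S n) = n := fun n =>
    Nat.mul_div_cancel' (sPart_dvd hS n)
  have hpt : ∀ n ∈ Finset.Icc X' N, (sDivCount S n : ℝ) ^ 2 / (n : ℝ) ^ 2 ≤ F (φ n) := by
    intro n hn
    rw [Finset.mem_Icc] at hn
    have hn0 : n ≠ 0 := by omega
    set r := sPart S n with hr
    set m := n / sPart S n with hm
    have hrm : r * m = n := hmul n
    have hr0 : (0 : ℝ) < r := by exact_mod_cast sPart_pos hS n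
    have hm0 : (0 : ℝ) < m := by
      have : 0 < m := Nat.pos_of_ne_zero (fun h => hn0 (by rw [← hrm, h, mul_zero]))
      exact_mod_cast this
    have hD : (sDivCount S n : ℝ) ≤ σ 0 r := by exact_mod_cast card_sDivisors_le_sigma hS hn0
    have hnR : (n : ℝ) = r * m := by rw [← hrm]; push_cast; ring
    simp only [hF, hφ]
    rw [← hr, ← hm, hnR, wt]
    have hD0 : (0 : ℝ) ≤ sDivCount S n := Nat.cast_nonneg _
    calc (sDivCount S n : ℝ) ^ 2 / ((r : ℝ) * m) ^ 2 ≤ ((σ 0 r : ℕ) : ℝ) ^ 2 / ((r : ℝ) * m) ^ 2 := by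
          gcongr
      _ = ((σ 0 r : ℕ) : ℝ) ^ 2 / r / (r * (m : ℝ) ^ 2) := by field_simp
  have hmaps : ∀ n ∈ Finset.Icc X' N, φ n ∈ Tgt := by
    intro n hn
    rw [Finset.mem_Icc] at hn
    have hn0 : n ≠ 0 := by omega
    simp only [hTgt, hR, hφ, Finset.mem_filter, Finset.mem_product, Finset.mem_Icc]
    refine ⟨⟨⟨⟨sPart_pos hS n, (sPart_le hS hn0).trans hn.2⟩, sPart_mem_factoredNumbers hS n⟩,
      ⟨Nat.pos_of_ne_zero (fun h => hn0 (by rw [← hmul n, h, mul_zero])),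
        (Nat.div_le_self _ _).trans hn.2⟩⟩, ?_⟩
    rw [hmul n]; exact hn.1
  have hinj : Set.InjOn φ ↑(Finset.Icc X' N) := by
    intro a _ b _ h
    have h1 := congrArg (fun x : ℕ × ℕ => x.1 * x.2) h
    simpa only [hφ, hmul] using h1
  -- reindex
  have step1 : ∑ n ∈ Finset.Icc X' N, (sDivCount S n : ℝ) ^ 2 / (n : ℝ) ^ 2 ≤ ∑ x ∈ Tgt, F x := by
    calc ∑ n ∈ Finset.Icc X' N, (sDivCount S n : ℝ) ^ 2 / (n : ℝ) ^ 2
        ≤ ∑ n ∈ Finset.Icc X' N, F (φ n) := Finset.sum_le_sum hpt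
      _ = ∑ x ∈ (Finset.Icc X' N).image φ, F x := (Finset.sum_image hinj).symm
      _ ≤ ∑ x ∈ Tgt, F x := Finset.sum_le_sum_of_subset_of_nonneg
          (Finset.image_subset_iff.2 hmaps) fun x _ _ => hF0 x
  -- evaluate the double sum
  have step2 : ∑ x ∈ Tgt, F x ≤ ∑ r ∈ R, wt r / r * (2 * r / X') := by
    rw [hTgt, Finset.sum_filter, Finset.sum_product]
    refine Finset.sum_le_sum fun r hr => ?_
    have hr1 : 1 ≤ r := (Finset.mem_Icc.1 (Finset.mem_filter.1 hr).1).1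
    have hr0 : (0 : ℝ) < r := by exact_mod_cast hr1
    rw [← Finset.sum_filter]
    have e : ∀ m ∈ (Finset.Icc 1 N).filter (fun m => X' ≤ r * m), F (r, m) = wt r / r * (1 / (m : ℝ) ^ 2) := by
      intro m _; simp only [hF]; field_simp
    rw [Finset.sum_congr rfl e, ← Finset.mul_sum]
    exact mul_le_mul_of_nonneg_left (sum_inv_sq_filter_le hX' hr1) (div_nonneg (wt_nonneg _) hr0.le)
  have step3 : ∑ r ∈ R, wt r / r * (2 * r / X') = 2 / X' * ∑ r ∈ R, wt r := by
    rw [Finset.mul_sum]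
    refine Finset.sum_congr rfl fun r hr => ?_
    have hr1 : 1 ≤ r := (Finset.mem_Icc.1 (Finset.mem_filter.1 hr).1).1
    have hr0 : (r : ℝ) ≠ 0 := by exact_mod_cast (show r ≠ 0 by omega)
    field_simp
  have step4 : ∑ r ∈ R, wt r ≤ Real.exp 102 :=
    sum_wt_le hY₁ hS hSY hcard fun r hr => (Finset.mem_filter.1 hr).2
  calc ∑ n ∈ Finset.Icc X' N, (sDivCount S n : ℝ) ^ 2 / (n : ℝ) ^ 2 ≤ ∑ x ∈ Tgt, F x := step1
    _ ≤ ∑ r ∈ R, wt r / r * (2 * r / X') := step2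
    _ = 2 / X' * ∑ r ∈ R, wt r := step3
    _ ≤ 2 / X' * Real.exp 102 := mul_le_mul_of_nonneg_left step4 (by positivity)


/-! ### Expanding `Q(s)^ℓ A(s)` as a Dirichlet polynomial -/

open Literature.NumberTheory.LFunctions.DirichletLargeValues (natCast_prod_cpow card_filter_prod_eq_le_factorial)

variable {ℓ : ℕ}

/-- The value `n = m ∏ᵢ pᵢ` attached to an index `(p⃗, m)`. [folklore] -/
def idxVal (j : (Fin ℓ → ℕ) × ℕ) : ℕ := j.2 * ∏ i, j.1 i

/-- The weight `a_m ∏ᵢ c_{pᵢ}` attached to an index `(p⃗, m)`. [folklore] -/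
def idxWt (a c : ℕ → ℂ) (j : (Fin ℓ → ℕ) × ℕ) : ℂ := (∏ i, c (j.1 i)) * a j.2

/-- The regrouped coefficient `b_n = ∑_{(p⃗, m) : m ∏ pᵢ = n} a_m ∏ c_{pᵢ}`. [folklore] -/
def coeffB (S Mset : Finset ℕ) (ℓ : ℕ) (a c : ℕ → ℂ) (n : ℕ) : ℂ :=
  ∑ j ∈ ((Fintype.piFinset fun _ : Fin ℓ => S) ×ˢ Mset).filter (fun j => idxVal j = n), idxWt a c j

/-- **Expansion**: `(∑_{p ∈ S} c_p p^{-s})^ℓ (∑_{m ∈ M} a_m m^{-s}) = ∑_{n ≤ N} b_n n^{-s}` as soon as all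
the products `m ∏ pᵢ` lie in `[1, N]`. [folklore] -/
theorem pow_mul_eq_sum_coeffB (S Mset : Finset ℕ) (ℓ : ℕ) (a c : ℕ → ℂ) (s : ℂ) (N : ℕ)
    (hN : ∀ j ∈ (Fintype.piFinset fun _ : Fin ℓ => S) ×ˢ Mset, idxVal j ∈ Finset.Icc 1 N) :
    (∑ p ∈ S, c p * (p : ℂ) ^ (-s)) ^ ℓ * ∑ m ∈ Mset, a m * (m : ℂ) ^ (-s)
      = ∑ n ∈ Finset.Icc 1 N, coeffB S Mset ℓ a c n * (n : ℂ) ^ (-s) := by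
  classical
  -- expand the power
  have h1 : (∑ p ∈ S, c p * (p : ℂ) ^ (-s)) ^ ℓ
      = ∑ u ∈ Fintype.piFinset (fun _ : Fin ℓ => S), (∏ i, c (u i)) * ((∏ i, u i : ℕ) : ℂ) ^ (-s) := by
    have e : (∑ p ∈ S, c p * (p : ℂ) ^ (-s)) ^ ℓ = ∏ _i : Fin ℓ, ∑ p ∈ S, c p * (p : ℂ) ^ (-s) := by
      simp
    rw [e, Finset.prod_univ_sum]
    refine Finset.sum_congr rfl fun u _ => ?_
    rw [Finset.prod_mul_distrib, natCast_prod_cpow]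
  -- multiply by `A` and combine the bases
  have h2 : (∑ u ∈ Fintype.piFinset (fun _ : Fin ℓ => S), (∏ i, c (u i)) * ((∏ i, u i : ℕ) : ℂ) ^ (-s))
        * ∑ m ∈ Mset, a m * (m : ℂ) ^ (-s)
      = ∑ j ∈ (Fintype.piFinset fun _ : Fin ℓ => S) ×ˢ Mset, idxWt a c j * ((idxVal j : ℕ) : ℂ) ^ (-s) := by
    rw [Finset.sum_mul_sum, ← Finset.sum_product']
    refine Finset.sum_congr rfl fun j _ => ?_
    rw [idxWt, idxVal, Nat.cast_mul, Complex.natCast_mul_natCast_cpow]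
    ring
  rw [h1, h2, ← Finset.sum_fiberwise_of_maps_to hN]
  refine Finset.sum_congr rfl fun n _ => ?_
  rw [coeffB, Finset.sum_mul]
  refine Finset.sum_congr rfl fun j hj => ?_
  rw [(Finset.mem_filter.1 hj).2]

/-- **The coefficient bound** `‖b_n‖ ≤ ℓ! · D_S(n)` for `n ≠ 0`, when `S` consists of primes and the
weights are `1`-bounded: the fibre over `n` maps to the `S`-factored divisors `r = ∏ pᵢ` of `n`, with at
most `ℓ!` prime tuples over each `r` (`card_filter_prod_eq_le_factorial`) and `m = n/r` determined.
[cite: MatomakiRadziwillAnnals2016, Lemma 13 (proof, the bound ℓ! g(n))] -/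
theorem norm_coeffB_le {S Mset : Finset ℕ} (hS : ∀ p ∈ S, p.Prime) {a c : ℕ → ℂ}
    (ha : ∀ m, ‖a m‖ ≤ 1) (hc : ∀ p, ‖c p‖ ≤ 1) {n : ℕ} (hn : n ≠ 0) :
    ‖coeffB S Mset ℓ a c n‖ ≤ (ℓ.factorial : ℝ) * sDivCount S n := by
  classical
  set J := (Fintype.piFinset fun _ : Fin ℓ => S) ×ˢ Mset with hJ
  set Fib := J.filter (fun j => idxVal j = n) with hFib
  -- each weight has norm `≤ 1`
  have hw : ∀ j ∈ Fib, ‖idxWt a c j‖ ≤ 1 := by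
    intro j _
    rw [idxWt, norm_mul, norm_prod]
    calc (∏ i, ‖c (j.1 i)‖) * ‖a j.2‖ ≤ 1 * 1 :=
          mul_le_mul (Finset.prod_le_one (fun i _ => norm_nonneg _) fun i _ => hc _) (ha _)
            (norm_nonneg _) zero_le_one
      _ = 1 := one_mul 1
  have hnorm : ‖coeffB S Mset ℓ a c n‖ ≤ #Fib := by
    rw [coeffB, ← hJ, ← hFib]
    refine (norm_sum_le _ _).trans ?_
    calc ∑ j ∈ Fib, ‖idxWt a c j‖ ≤ ∑ j ∈ Fib, (1 : ℝ) := Finset.sum_le_sum hw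
      _ = #Fib := by simp
  -- count the fibre through the map `j ↦ ∏ pᵢ`
  set D := n.divisors.filter (fun r => r.primeFactors ⊆ S) with hD
  have hmaps : ∀ j ∈ Fib, (∏ i, j.1 i) ∈ D := by
    intro j hj
    rw [hFib, Finset.mem_filter, hJ, Finset.mem_product, Fintype.mem_piFinset] at hj
    obtain ⟨⟨hu, -⟩, hv⟩ := hj
    rw [hD, Finset.mem_filter, Nat.mem_divisors]
    refine ⟨⟨Dvd.intro_left _ hv, hn⟩, ?_⟩
    intro q hq
    rw [Nat.mem_primeFactors] at hq
    obtain ⟨hqp, hqd, -⟩ := hq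
    obtain ⟨i, -, hi⟩ := ((Nat.prime_iff.mp hqp).dvd_finsetProd_iff _).1 hqd
    rw [(Nat.prime_dvd_prime_iff_eq hqp (hS _ (hu i))).1 hi]
    exact hu i
  have hcount : #Fib ≤ ℓ.factorial * #D := by
    rw [Finset.card_eq_sum_card_fiberwise hmaps, mul_comm]
    refine (Finset.sum_le_sum (fun r hr => ?_)).trans (by rw [Finset.sum_const, smul_eq_mul])
    -- the sub-fibre over `r` injects into `{u : ∏ u = r}` via `j ↦ j.1`
    have hr0 : r ≠ 0 := Nat.ne_of_gt (Nat.pos_of_mem_divisors (Finset.mem_filter.1 hr).1)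
    calc #(Fib.filter (fun j => (∏ i, j.1 i) = r))
        ≤ #((Fintype.piFinset fun _ : Fin ℓ => S).filter (fun u => ∏ i, u i = r)) := by
          refine Finset.card_le_card_of_injOn (fun j => j.1) (fun j hj => ?_) ?_
          · rw [Finset.mem_coe, Finset.mem_filter] at hj
            rw [Finset.mem_coe, Finset.mem_filter]
            have hj1 := hj.1
            rw [hFib, Finset.mem_filter, hJ, Finset.mem_product] at hj1
            exact ⟨hj1.1.1, hj.2⟩
          · intro j hj j' hj' hjj'
            rw [Finset.mem_coe, Finset.mem_filter] at hj hj'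
            have hv := (Finset.mem_filter.1 hj.1).2
            have hv' := (Finset.mem_filter.1 hj'.1).2
            rw [idxVal] at hv hv'
            have h2 : j.2 = j'.2 := by
              have e1 : j.2 * r = n := by rw [← hj.2]; exact hv
              have e2 : j'.2 * r = n := by rw [← hj'.2]; exact hv'
              exact Nat.eq_of_mul_eq_mul_right (Nat.pos_of_ne_zero hr0) (e1.trans e2.symm)
            exact Prod.ext hjj' h2
      _ ≤ ℓ.factorial := card_filter_prod_eq_le_factorial ℓ S hS r
  calc ‖coeffB S Mset ℓ a c n‖ ≤ #Fib := hnorm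
    _ ≤ ((ℓ.factorial * #D : ℕ) : ℝ) := by exact_mod_cast hcount
    _ = (ℓ.factorial : ℝ) * sDivCount S n := by rw [sDivCount, ← hD]; push_cast; ring

/-- If the fibre over `n` is empty then `b_n = 0`; in particular `b_n ≠ 0` forces `n = m ∏ pᵢ` for some
index. [folklore] -/
theorem exists_of_coeffB_ne_zero {S Mset : Finset ℕ} {a c : ℕ → ℂ} {n : ℕ}
    (h : coeffB S Mset ℓ a c n ≠ 0) :
    ∃ j ∈ (Fintype.piFinset fun _ : Fin ℓ => S) ×ˢ Mset, idxVal j = n := by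
  classical
  by_contra hne
  push Not at hne
  apply h
  rw [coeffB]
  refine Finset.sum_eq_zero fun j hj => ?_
  rw [Finset.mem_filter] at hj
  exact absurd hj.2 (hne j hj.1)


/-! ### Assembly -/

/-- `n^{-(1+it)} = n⁻¹ · n^{-it}` for `n ≠ 0`. [folklore] -/
theorem cpow_neg_one_add {n : ℕ} (hn : n ≠ 0) (t : ℝ) :
    (n : ℂ) ^ (-(1 + (t : ℂ) * I)) = (n : ℂ)⁻¹ * (n : ℂ) ^ (-((t : ℂ) * I)) := by
  rw [neg_add, Complex.cpow_add _ _ (by exact_mod_cast hn), Complex.cpow_neg_one]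

end MatomakiRadziwillL13

open MatomakiRadziwillL13 in
/-- **Matomäki–Radziwiłł 2016, Lemma 13 (moment computation), proved** with the absolute constant
`C = 72 e^{102}`: for `X, T ≥ 1`, `Y₁ ≥ 2`, `Y₂ ≥ 1`, `|a_m|, |c_p| ≤ 1`, `ℓ = ⌈log Y₂/log Y₁⌉`,
`∫_{-T}^{T} |Q(1+it)^ℓ A(1+it)|² dt ≤ C (T/X + 2^ℓ Y₁) ((ℓ+1)!)²`.
Proof (the paper's, §6, with Shiu's theorem replaced by the elementary `sum_sDivCount_sq_le`):
`Q^ℓ A = ∑_{X ≤ n ≤ N} b_n n^{-s}` with `N ≤ 2^{ℓ+1} X Y₁` (`pow_mul_eq_sum_coeffB`; the support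
starts at `X` because `Y₁^ℓ ≥ Y₂`), `|b_n| ≤ ℓ! D_S(n)` (`norm_coeffB_le`), the mean value theorem
`∫_{-T}^{T} |∑ d_n n^{-it}|² ≤ (5T + 18N) ∑ |d_n|²` (`LFunctions.dirichletPolynomial_meanSquare_le`) with
`d_n = b_n/n`, and `∑_{n ≥ X} D_S(n)²/n² ≤ 2e^{102}/X`. [cite: MatomakiRadziwillAnnals2016, Lemma 13] -/
theorem MatomakiRadziwill2016_lemma13_holds : MatomakiRadziwill2016_lemma13 := by
  refine ⟨72 * Real.exp 102, ?_⟩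
  intro X T Y₁ Y₂ a c hX hT hY₁ hY₂ ha hc
  classical
  -- notation
  set S : Finset ℕ := (Finset.Icc ⌈Y₁⌉₊ ⌊2 * Y₁⌋₊).filter Nat.Prime with hSdef
  set ℓ : ℕ := ⌈Real.log Y₂ / Real.log Y₁⌉₊ with hℓ
  set Mset : Finset ℕ := Finset.Icc ⌈X / Y₂⌉₊ ⌊2 * X / Y₂⌋₊ with hMset
  set N : ℕ := ⌊2 * X / Y₂⌋₊ * ⌊2 * Y₁⌋₊ ^ ℓ with hNdef
  set J : Finset ((Fin ℓ → ℕ) × ℕ) := (Fintype.piFinset fun _ : Fin ℓ => S) ×ˢ Mset with hJ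
  set b : ℕ → ℂ := coeffB S Mset ℓ a c with hb
  have hX0 : 0 < X := by linarith
  have hT0 : 0 < T := by linarith
  have hY₁0 : 0 < Y₁ := by linarith
  have hY₂0 : 0 < Y₂ := by linarith
  have hlogY₁ : 0 < Real.log Y₁ := Real.log_pos (by linarith)
  have hlogY₂ : 0 ≤ Real.log Y₂ := Real.log_nonneg hY₂
  -- the set `S`
  have hS : ∀ p ∈ S, p.Prime := fun p hp => (Finset.mem_filter.1 hp).2
  have hSY : ∀ p ∈ S, Y₁ ≤ p := fun p hp =>
    Nat.ceil_le.1 (Finset.mem_Icc.1 (Finset.mem_filter.1 hp).1).1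
  have hS2Y : ∀ p ∈ S, (p : ℝ) ≤ 2 * Y₁ := fun p hp => by
    have := (Finset.mem_Icc.1 (Finset.mem_filter.1 hp).1).2
    exact (Nat.cast_le.2 this).trans (Nat.floor_le (by linarith))
  have hcard : (#S : ℝ) ≤ Y₁ + 1 := by
    have h1 : #S ≤ ⌊2 * Y₁⌋₊ + 1 - ⌈Y₁⌉₊ := (Finset.card_filter_le _ _).trans (by rw [Nat.card_Icc])
    have h2 : ((⌊2 * Y₁⌋₊ + 1 - ⌈Y₁⌉₊ : ℕ) : ℝ) ≤ Y₁ + 1 := by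
      have hf : (⌊2 * Y₁⌋₊ : ℝ) ≤ 2 * Y₁ := Nat.floor_le (by linarith)
      have hc : Y₁ ≤ ⌈Y₁⌉₊ := Nat.le_ceil Y₁
      rcases le_or_gt ⌈Y₁⌉₊ (⌊2 * Y₁⌋₊ + 1) with h | h
      · rw [Nat.cast_sub h]; push_cast; linarith
      · rw [Nat.sub_eq_zero_of_le h.le]; push_cast; linarith
    exact (Nat.cast_le.2 h1).trans h2
  -- `Y₂ ≤ Y₁^ℓ ≤ Y₁ Y₂`
  have hℓge : Real.log Y₂ / Real.log Y₁ ≤ ℓ := Nat.le_ceil _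
  have hℓlt : (ℓ : ℝ) < Real.log Y₂ / Real.log Y₁ + 1 := Nat.ceil_lt_add_one (by positivity)
  have hpow_ge : Y₂ ≤ Y₁ ^ ℓ := by
    have h1 : Real.log Y₂ ≤ Real.log (Y₁ ^ ℓ) := by
      rw [Real.log_pow]; rw [div_le_iff₀ hlogY₁] at hℓge; linarith
    exact (Real.log_le_log_iff hY₂0 (by positivity)).1 h1
  have hpow_le : Y₁ ^ ℓ ≤ Y₁ * Y₂ := by
    have h1 : Real.log (Y₁ ^ ℓ) ≤ Real.log (Y₁ * Y₂) := by
      rw [Real.log_pow, Real.log_mul hY₁0.ne' hY₂0.ne']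
      have h2 : ((ℓ : ℝ) - 1) * Real.log Y₁ < Real.log Y₂ := by
        rw [← lt_div_iff₀ hlogY₁]; linarith
      have e : ((ℓ : ℝ) - 1) * Real.log Y₁ = ℓ * Real.log Y₁ - Real.log Y₁ := by ring
      linarith
    exact (Real.log_le_log_iff (by positivity) (by positivity)).1 h1
  -- indices: values in `[1, N]`, and `≥ X`
  have hJmem : ∀ j ∈ J, (∀ i, j.1 i ∈ S) ∧ j.2 ∈ Mset := fun j hj => by
    rw [hJ, Finset.mem_product, Fintype.mem_piFinset] at hj; exact hj
  have hN : ∀ j ∈ J, idxVal j ∈ Finset.Icc 1 N := by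
    intro j hj
    obtain ⟨hu, hm⟩ := hJmem j hj
    rw [hMset, Finset.mem_Icc] at hm
    have hm1 : 1 ≤ j.2 := le_trans (Nat.one_le_iff_ne_zero.2 (Nat.ceil_pos.2 (by positivity)).ne') hm.1
    rw [Finset.mem_Icc, idxVal]
    constructor
    · refine Nat.one_le_iff_ne_zero.2 (Nat.mul_ne_zero (by omega) ?_)
      exact Finset.prod_ne_zero_iff.2 fun i _ => (hS _ (hu i)).ne_zero
    · rw [hNdef]
      refine Nat.mul_le_mul hm.2 ?_
      calc ∏ i, j.1 i ≤ ∏ _i : Fin ℓ, ⌊2 * Y₁⌋₊ :=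
            Finset.prod_le_prod (fun i _ => Nat.zero_le _) fun i _ =>
              (Finset.mem_Icc.1 (Finset.mem_filter.1 (hu i)).1).2
        _ = ⌊2 * Y₁⌋₊ ^ ℓ := by rw [Finset.prod_const, Finset.card_univ, Fintype.card_fin]
  have hJX : ∀ j ∈ J, X ≤ (idxVal j : ℝ) := by
    intro j hj
    obtain ⟨hu, hm⟩ := hJmem j hj
    rw [hMset, Finset.mem_Icc] at hm
    have hm' : X / Y₂ ≤ (j.2 : ℝ) := Nat.ceil_le.1 hm.1
    have hprod : Y₁ ^ ℓ ≤ ((∏ i, j.1 i : ℕ) : ℝ) := by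
      rw [Nat.cast_prod]
      calc Y₁ ^ ℓ = ∏ _i : Fin ℓ, Y₁ := by rw [Finset.prod_const, Finset.card_univ, Fintype.card_fin]
        _ ≤ ∏ i, ((j.1 i : ℕ) : ℝ) := Finset.prod_le_prod (fun i _ => hY₁0.le) fun i _ => hSY _ (hu i)
    rw [idxVal, Nat.cast_mul]
    calc X = X / Y₂ * Y₂ := by field_simp
      _ ≤ (j.2 : ℝ) * Y₁ ^ ℓ := mul_le_mul hm' hpow_ge hY₂0.le (Nat.cast_nonneg _)
      _ ≤ (j.2 : ℝ) * ((∏ i, j.1 i : ℕ) : ℝ) := mul_le_mul_of_nonneg_left hprod (Nat.cast_nonneg _)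
  -- the integrand as a Dirichlet polynomial with coefficients `b_n / n`
  have hrepr : ∀ t : ℝ,
      (∑ p ∈ S, c p * (p : ℂ) ^ (-(1 + (t : ℂ) * I))) ^ ℓ *
          ∑ m ∈ Mset, a m * (m : ℂ) ^ (-(1 + (t : ℂ) * I))
        = ∑ n ∈ Finset.Icc 1 N, (b n / n) * (n : ℂ) ^ (-((t : ℂ) * I)) := by
    intro t
    rw [pow_mul_eq_sum_coeffB S Mset ℓ a c (1 + (t : ℂ) * I) N hN]
    refine Finset.sum_congr rfl fun n hn => ?_
    have hn0 : n ≠ 0 := by have := (Finset.mem_Icc.1 hn).1; omega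
    rw [cpow_neg_one_add hn0, hb]
    field_simp
  -- mean value theorem
  have hMVT := Literature.NumberTheory.LFunctions.dirichletPolynomial_meanSquare_le (fun n => b n / n) N hT0
  -- the coefficient sum
  set X' : ℕ := ⌈X⌉₊ with hX'
  have hX'1 : 1 ≤ X' := Nat.one_le_iff_ne_zero.2 (Nat.ceil_pos.2 hX0).ne'
  have hX'X : X ≤ X' := Nat.le_ceil X
  have hcoef : ∑ n ∈ Finset.Icc 1 N, ‖b n / n‖ ^ 2
      ≤ (ℓ.factorial : ℝ) ^ 2 * ∑ n ∈ Finset.Icc X' N, (sDivCount S n : ℝ) ^ 2 / (n : ℝ) ^ 2 := by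
    -- terms below `X'` vanish, the others are bounded by `(ℓ! D_S(n))²/n²`
    set g : ℕ → ℝ := fun n => if X' ≤ n then (ℓ.factorial : ℝ) ^ 2 * ((sDivCount S n : ℝ) ^ 2 / (n : ℝ) ^ 2) else 0 with hg
    have hpt : ∀ n ∈ Finset.Icc 1 N, ‖b n / n‖ ^ 2 ≤ g n := by
      intro n hn
      have hn0 : n ≠ 0 := by have := (Finset.mem_Icc.1 hn).1; omega
      simp only [hg]
      split_ifs with hle
      · rw [norm_div, div_pow, Complex.norm_natCast]
        have h1 := norm_coeffB_le (Mset := Mset) (ℓ := ℓ) hS ha hc hn0 (a := a) (c := c)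
        rw [← hb] at h1
        have h2 : ‖b n‖ ^ 2 ≤ ((ℓ.factorial : ℝ) * sDivCount S n) ^ 2 := pow_le_pow_left₀ (norm_nonneg _) h1 2
        calc ‖b n‖ ^ 2 / (n : ℝ) ^ 2 ≤ ((ℓ.factorial : ℝ) * sDivCount S n) ^ 2 / (n : ℝ) ^ 2 :=
              div_le_div_of_nonneg_right h2 (by positivity)
          _ = (ℓ.factorial : ℝ) ^ 2 * ((sDivCount S n : ℝ) ^ 2 / (n : ℝ) ^ 2) := by ring
      · -- `b n = 0`
        have hb0 : b n = 0 := by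
          by_contra hne
          obtain ⟨j, hj, hjn⟩ := exists_of_coeffB_ne_zero (by rw [hb] at hne; exact hne)
          have := hJX j hj
          rw [hjn] at this
          exact hle (Nat.ceil_le.2 this)
        rw [hb0, zero_div, norm_zero]; simp
    calc ∑ n ∈ Finset.Icc 1 N, ‖b n / n‖ ^ 2 ≤ ∑ n ∈ Finset.Icc 1 N, g n := Finset.sum_le_sum hpt
      _ = ∑ n ∈ (Finset.Icc 1 N).filter (fun n => X' ≤ n),
            (ℓ.factorial : ℝ) ^ 2 * ((sDivCount S n : ℝ) ^ 2 / (n : ℝ) ^ 2) := by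
          rw [hg, Finset.sum_filter]
      _ ≤ ∑ n ∈ Finset.Icc X' N, (ℓ.factorial : ℝ) ^ 2 * ((sDivCount S n : ℝ) ^ 2 / (n : ℝ) ^ 2) := by
          refine Finset.sum_le_sum_of_subset_of_nonneg (fun n hn => ?_) fun _ _ _ => by positivity
          rw [Finset.mem_filter, Finset.mem_Icc] at hn
          rw [Finset.mem_Icc]; exact ⟨hn.2, hn.1.2⟩
      _ = (ℓ.factorial : ℝ) ^ 2 * ∑ n ∈ Finset.Icc X' N, (sDivCount S n : ℝ) ^ 2 / (n : ℝ) ^ 2 := by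
          rw [Finset.mul_sum]
  have hshiu := sum_sDivCount_sq_le (N := N) hY₁ hS hSY hcard hX'1
  have hcoef' : ∑ n ∈ Finset.Icc 1 N, ‖b n / n‖ ^ 2 ≤ (ℓ.factorial : ℝ) ^ 2 * (2 / X * Real.exp 102) := by
    refine hcoef.trans (mul_le_mul_of_nonneg_left (hshiu.trans ?_) (by positivity))
    have hX'0 : (0 : ℝ) < X' := by exact_mod_cast hX'1
    refine mul_le_mul_of_nonneg_right (div_le_div_of_nonneg_left (by norm_num) hX0 hX'X) (by positivity)
  -- the length `N`
  have hNle : (N : ℝ) ≤ 2 * 2 ^ ℓ * X * Y₁ := by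
    rw [hNdef]; push_cast
    have h1 : (⌊2 * X / Y₂⌋₊ : ℝ) ≤ 2 * X / Y₂ := Nat.floor_le (by positivity)
    have h2 : ((⌊2 * Y₁⌋₊ : ℕ) : ℝ) ^ ℓ ≤ (2 * Y₁) ^ ℓ :=
      pow_le_pow_left₀ (Nat.cast_nonneg _) (Nat.floor_le (by linarith)) ℓ
    calc (⌊2 * X / Y₂⌋₊ : ℝ) * ((⌊2 * Y₁⌋₊ : ℕ) : ℝ) ^ ℓ ≤ (2 * X / Y₂) * (2 * Y₁) ^ ℓ :=
          mul_le_mul h1 h2 (by positivity) (by positivity)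
      _ = 2 * 2 ^ ℓ * X * (Y₁ ^ ℓ / Y₂) := by rw [mul_pow]; field_simp
      _ ≤ 2 * 2 ^ ℓ * X * Y₁ := by
          refine mul_le_mul_of_nonneg_left ?_ (by positivity)
          rw [div_le_iff₀ hY₂0]; exact hpow_le
  -- assembly
  have hfac : (ℓ.factorial : ℝ) ^ 2 ≤ ((ℓ + 1).factorial : ℝ) ^ 2 := by
    have : (ℓ.factorial : ℝ) ≤ (ℓ + 1).factorial := by exact_mod_cast Nat.factorial_le (Nat.le_succ ℓ)
    exact pow_le_pow_left₀ (Nat.cast_nonneg _) this 2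
  have hsum0 : 0 ≤ ∑ n ∈ Finset.Icc 1 N, ‖b n / n‖ ^ 2 := Finset.sum_nonneg fun _ _ => sq_nonneg _
  calc ∫ t in (-T)..T, ‖(∑ p ∈ S, c p * (p : ℂ) ^ (-(1 + (t : ℂ) * I))) ^ ℓ *
          ∑ m ∈ Mset, a m * (m : ℂ) ^ (-(1 + (t : ℂ) * I))‖ ^ 2
      = ∫ t in (-T)..T, ‖∑ n ∈ Finset.Icc 1 N, (b n / n) * (n : ℂ) ^ (-((t : ℂ) * I))‖ ^ 2 := by
        refine intervalIntegral.integral_congr fun t _ => ?_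
        simp only [hrepr t]
    _ ≤ (5 * T + 18 * N) * ∑ n ∈ Finset.Icc 1 N, ‖b n / n‖ ^ 2 := hMVT
    _ ≤ (5 * T + 18 * (2 * 2 ^ ℓ * X * Y₁)) * ((ℓ.factorial : ℝ) ^ 2 * (2 / X * Real.exp 102)) := by
        refine mul_le_mul (by linarith) hcoef' hsum0 (by positivity)
    _ = 72 * Real.exp 102 * (5 / 36 * (T / X) + 2 ^ ℓ * Y₁) * (ℓ.factorial : ℝ) ^ 2 := by
        field_simp; ring
    _ ≤ 72 * Real.exp 102 * (T / X + 2 ^ ℓ * Y₁) * ((ℓ + 1).factorial : ℝ) ^ 2 := by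
        refine mul_le_mul (mul_le_mul_of_nonneg_left ?_ (by positivity)) hfac (by positivity) (by positivity)
        have : 0 ≤ T / X := by positivity
        linarith

end Literature.NumberTheory.Sieve
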